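import Literature.Analysis.FunctionSpaces.TorusLinearisedNSForcedVGrowth

/-!
# `V`-growth of the inhomogeneous linearised flow with integrable coefficients (tools stub
# `stub_linearisedForcedVGrowthTools` of block N-R, line `ergodic-budget-selection-closing`,
# crux `BaireTransfer.DenseLoudDesignerForces`, stmt-AnomalousDissipation-1143)

Summit-side wrapper, at `d = Fin 3`, of the Literature estimate
`Literature.Analysis.FunctionSpaces.Torus.linearisedNSForced_h1_le_mul_of_integral_laplacian_sq_le`
(`Literature/Analysis/FunctionSpaces/TorusLinearisedNSForcedVGrowth.lean`): for `ν > 0`, `M₁`, `Y` and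
`τ > 0` there is `C = C(ν, M₁, Y, τ)` such that along a classical Navier–Stokes solution `u` on
`[a, a + τ] × T³` with zero-mean slices, `‖∇u(t)‖₂² ≤ M₁` and `∫ₐ^{a+τ} ‖Δu‖₂² ≤ Y`, every smooth
divergence-free zero-mean solution `(w, q)` of the inhomogeneous linearised equation
`∂ₜw + (u·∇)w + (w·∇)u = νΔw − ∇q + g` satisfies
`‖w(t)‖²_{L²} + ‖∇w(t)‖₂² ≤ C (‖w(a)‖²_{L²} + ‖∇w(a)‖₂² + ∫ₐᵗ ‖g(s)‖²_{L²} ds)` — the linear twin of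
the `V`-stability estimate `stub_vStabilityTools` (`…ErgodicVStability.lean`), with constants
depending on the base solution only through `M₁` and `Y` (no sup norm of `u`), the form needed at
`V`-data base points by the remainder estimates of the `C²` dependence of the solution map (block N-R
of the smooth-model construction).  The mathematics (flux bounds of
`TorusClassicalNSVStabilityFlux.lean` with `ε = ν/4`, Young for the source pairings, Grönwall with a
continuous integrable coefficient and a source, `Literature.Analysis.ODE.le_linearComparison`) is in the
Literature file; the base solution enters only through the joint smoothness and incompressibility of
its velocity.

References: Constantin–Foias, *Navier–Stokes Equations* (1988) Ch. 14, (14.2)–(14.4), Lemma 14.3;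
Ch. 10, Thm. 10.2 (10.7).
-/

-- `Summit.<Summit>.<Problem>` is the tree's mandated summit-side namespace (CONVENTIONS §2); for this
-- single-conjunct summit the two coincide, so the duplicate is deliberate.
set_option linter.dupNamespace false

noncomputable section

open scoped BigOperators Topology ENNReal InnerProductSpace
open Filter Set Function MeasureTheory

namespace Summit.AnomalousDissipation.AnomalousDissipation.Theorems.DenseLoudDesignerForces.Ergodic

open Literature.Analysis.FunctionSpaces Literature.Analysis.FunctionSpaces.Torus
open Literature.Analysis.FluidPDE Literature.Analysis.FluidPDE.Torus

/-- **Tools stub N-R — `V`-growth of the inhomogeneous linearised flow with integrable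
coefficients** (registered tools stub `stub_linearisedForcedVGrowthTools` of block N, crux
stmt-AnomalousDissipation-1143, line `ergodic-budget-selection-closing`).  For `ν > 0` and `M₁, Y, τ`
(`τ > 0`) there is `C` such that along every classical solution `u` of NS_ν on `[a, a + τ] × T³` with
zero-mean slices, `‖∇u(t)‖₂² ≤ M₁` on the interval and `∫ₐ^{a+τ} ‖Δu(s)‖₂² ds ≤ Y`, every jointly
smooth `(w, q, g)` with `div w = 0`, `∫ w = 0` and
`∂ₜw + (u·∇)w + (w·∇)u = νΔw − ∇q + g` on `[a, a + τ] × T³` obeys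
`∫‖w(t)‖² + ‖∇w(t)‖₂² ≤ C (∫‖w(a)‖² + ‖∇w(a)‖₂² + ∫ₐᵗ ∫‖g(s)‖² ds)` for all `t ∈ [a, a + τ]`
(`Torus.linearisedNSForced_h1_le_mul_of_integral_laplacian_sq_le` at `d = Fin 3`, fed with the
smoothness and incompressibility of the base velocity; Constantin–Foias 1988, Ch. 14 (14.2)–(14.4),
one level up in `V`). [cite: ConstantinFoiasNSE1988, Ch. 14 (14.2)–(14.4)] -/
theorem stub_linearisedForcedVGrowthTools {ν : ℝ} (hν : 0 < ν) (M₁ Y τ : ℝ) (hτ : 0 < τ) :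
    ∃ C : ℝ, ∀ {a : ℝ} {f u : ℝ → (UnitAddTorus (Fin 3)) → (EuclideanSpace ℝ (Fin 3))} {p : ℝ → (UnitAddTorus (Fin 3)) → ℝ}
      {w g : ℝ → (UnitAddTorus (Fin 3)) → (EuclideanSpace ℝ (Fin 3))} {q : ℝ → (UnitAddTorus (Fin 3)) → ℝ},
      IsClassicalNSSolutionOn (Icc a (a + τ)) ν f u p → (∀ t ∈ Icc a (a + τ), HasZeroMean (u t)) →
      (∀ t ∈ Icc a (a + τ), gradNormSq (u t) ≤ M₁) → (∫ s in a..(a + τ), (∫ x, ‖laplacian (u s) x‖ ^ 2) ≤ Y) →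
      IsSmoothSpaceTimeOn (Icc a (a + τ)) w → IsSmoothSpaceTimeOn (Icc a (a + τ)) q → IsSmoothSpaceTimeOn (Icc a (a + τ)) g →
      (∀ t ∈ Icc a (a + τ), IsDivFree (w t)) → (∀ t ∈ Icc a (a + τ), HasZeroMean (w t)) →
      (∀ t ∈ Icc a (a + τ), ∀ x, Torus.timeDerivWithin (Icc a (a + τ)) w t x + convect (u t) (w t) x + convect (w t) (u t) x =
        ν • laplacian (w t) x - Torus.gradient (q t) x + g t x) →
      ∀ t ∈ Icc a (a + τ), (∫ x, ‖w t x‖ ^ 2) + gradNormSq (w t) ≤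
        C * ((∫ x, ‖w a x‖ ^ 2) + gradNormSq (w a) + ∫ s in a..t, ∫ x, ‖g s x‖ ^ 2) := by
  obtain ⟨C, hC⟩ := linearisedNSForced_h1_le_mul_of_integral_laplacian_sq_le (d := Fin 3)
    (Fintype.card_fin 3) hν M₁ Y τ hτ
  exact ⟨C, fun h hz hG hY hw hq hg hwdiv hwz hlin =>
    hC h.smooth_velocity h.divFree hz hG hY hw hq hg hwdiv hwz hlin⟩

end Summit.AnomalousDissipation.AnomalousDissipation.Theorems.DenseLoudDesignerForces.Ergodic

end
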